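import Summits.AtomisticToContinuum.FouriersLaw.Theorems.ParityLiouvilleSeedWindowLimitDefs
import Mathlib.MeasureTheory.Measure.Prokhorov
import Mathlib.MeasureTheory.Measure.Portmanteau
import Mathlib.MeasureTheory.Integral.DominatedConvergence

/-!
# Weak limits of window measures: transfer of integrals and Prokhorov extraction (helper for `WindowLimit`)

Helper file for the route item `ParityLiouvilleSeed.WindowLimit` (`stmt-AtomisticToContinuum-13982`).

* `lintegral_ofReal_le_of_tendsto`, `integrable_of_tendsto_of_integral_le` — Fatou along a weakly
  convergent sequence of probability measures for a nonnegative continuous (unbounded) function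
  (Mathlib's portmanteau `lintegral_le_liminf_lintegral_…`);
* `tendsto_integral_of_tendsto_of_sq_le` — **transfer of integrals**: if `κ_k → κ` weakly, `h` is
  continuous, `|h| ≤ G` with `G` continuous and `sup_k ∫ G² dκ_k ≤ M`, then `h ∈ L¹(κ)` and
  `∫ h dκ_k → ∫ h dκ` (uniform integrability by truncation at level `L`, error `≤ M/L`);
* `site_moment_window_le` — the window measures `(μ_N).map (embed N c)` inherit the site-uniform
  moment bounds of the family `μ` (zero padding outside the chain);
* `isTightMeasureSet_window`, `exists_weak_limit` — tightness from uniform second moments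
  (Chebyshev on each site, product of closed balls) and the Prokhorov extraction of a weakly convergent
  subsequence of the centred window measures `windowPM (μ N)` along any sequence of lengths.

Nothing here closes an item.
-/

noncomputable section

namespace Summit.AtomisticToContinuum.FouriersLaw.Theorems.WindowLimit

open MeasureTheory Filter Topology Set
open scoped ENNReal BoundedContinuousFunction
open Literature.MathematicalPhysics.KineticTheory.HeatConduction

/-! ### Fatou and transfer of integrals along weakly convergent probability measures -/

section Transfer

variable {X : Type*} [TopologicalSpace X] [MeasurableSpace X] [OpensMeasurableSpace X]
  [HasOuterApproxClosed X]

/-- **Fatou along weak convergence** for a nonnegative continuous function: a uniform bound on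
`∫⁻ F dκ_k` passes to the weak limit. [folklore] -/
theorem lintegral_ofReal_le_of_tendsto {κs : ℕ → ProbabilityMeasure X} {κ : ProbabilityMeasure X}
    (hlim : Tendsto κs atTop (𝓝 κ)) {F : X → ℝ} (hF : Continuous F) (hF0 : ∀ x, 0 ≤ F x) {B : ℝ≥0∞}
    (hB : ∀ k, ∫⁻ x, ENNReal.ofReal (F x) ∂(κs k : Measure X) ≤ B) :
    ∫⁻ x, ENNReal.ofReal (F x) ∂(κ : Measure X) ≤ B := by
  refine (lintegral_le_liminf_lintegral_of_forall_isOpen_measure_le_liminf_measure hF (fun x => hF0 x)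
    (fun G hG => ProbabilityMeasure.le_liminf_measure_open_of_tendsto hlim hG)).trans ?_
  exact Filter.liminf_le_of_frequently_le' (Eventually.of_forall hB).frequently

/-- A nonnegative continuous function with uniformly bounded integrals along a weakly convergent
sequence of probability measures is integrable for the limit, with the same bound. [folklore] -/
theorem integrable_of_tendsto_of_integral_le {κs : ℕ → ProbabilityMeasure X} {κ : ProbabilityMeasure X}
    (hlim : Tendsto κs atTop (𝓝 κ)) {F : X → ℝ} (hF : Continuous F) (hF0 : ∀ x, 0 ≤ F x) {M : ℝ}
    (hint : ∀ k, Integrable F (κs k : Measure X)) (hM : ∀ k, ∫ x, F x ∂(κs k : Measure X) ≤ M) :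
    Integrable F (κ : Measure X) ∧ ∫ x, F x ∂(κ : Measure X) ≤ M := by
  have hM0 : 0 ≤ M := le_trans (integral_nonneg fun x => hF0 x) (hM 0)
  have hB : ∀ k, ∫⁻ x, ENNReal.ofReal (F x) ∂(κs k : Measure X) ≤ ENNReal.ofReal M := fun k => by
    rw [← ofReal_integral_eq_lintegral_ofReal (hint k) (Eventually.of_forall fun x => hF0 x)]
    exact ENNReal.ofReal_le_ofReal (hM k)
  have hle := lintegral_ofReal_le_of_tendsto hlim hF hF0 hB
  have hfi : Integrable F (κ : Measure X) := by
    refine ⟨hF.aestronglyMeasurable, ?_⟩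
    rw [hasFiniteIntegral_iff_ofReal (Eventually.of_forall fun x => hF0 x)]
    exact lt_of_le_of_lt hle ENNReal.ofReal_lt_top
  refine ⟨hfi, ?_⟩
  rw [integral_eq_lintegral_of_nonneg_ae (Eventually.of_forall fun x => hF0 x) hF.aestronglyMeasurable]
  exact ENNReal.toReal_le_of_le_ofReal hM0 hle

omit [TopologicalSpace X] [MeasurableSpace X] [OpensMeasurableSpace X] [HasOuterApproxClosed X] in
/-- The two-sided truncation of a real function at level `L`: the error is `≤ G²/L` when `|h| ≤ G`.
[folklore] -/
theorem abs_sub_trunc_le {h G : X → ℝ} (hhG : ∀ x, |h x| ≤ G x) {L : ℝ} (hL : 0 < L) (x : X) :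
    |h x - max (-L) (min L (h x))| ≤ G x ^ 2 / L := by
  have hG := hhG x
  have hG0 : 0 ≤ G x := (abs_nonneg _).trans hG
  by_cases h1 : h x ≤ L
  · by_cases h2 : -L ≤ h x
    · rw [min_eq_right h1, max_eq_right h2, sub_self, abs_zero]; positivity
    · push Not at h2
      rw [min_eq_right h1, max_eq_left h2.le]
      have hhx : |h x| = -h x := abs_of_neg (by linarith)
      have hGL : L < G x := by linarith
      have : -h x ≤ G x ^ 2 / L := by
        rw [le_div_iff₀ hL]; nlinarith
      rw [abs_of_nonpos (by linarith)]; linarith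
  · push Not at h1
    rw [min_eq_left h1.le, max_eq_right (by linarith)]
    have hhx : |h x| = h x := abs_of_pos (by linarith)
    have hGL : L < G x := by linarith
    have : h x ≤ G x ^ 2 / L := by
      rw [le_div_iff₀ hL]; nlinarith
    rw [abs_of_nonneg (by linarith)]; linarith

omit [HasOuterApproxClosed X] in
/-- The truncation error in the integral: `|∫ h - ∫ h_L| ≤ M / L` whenever `∫ G² ≤ M`. [folklore] -/
theorem abs_integral_sub_integral_trunc_le (ρ : Measure X) [IsFiniteMeasure ρ] {h G : X → ℝ}
    (hh : Continuous h) (hhG : ∀ x, |h x| ≤ G x) (hGi : Integrable (fun x => G x ^ 2) ρ) {M : ℝ}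
    (hM : ∫ x, G x ^ 2 ∂ρ ≤ M) {L : ℝ} (hL : 0 < L) (hhi : Integrable h ρ) :
    |∫ x, h x ∂ρ - ∫ x, max (-L) (min L (h x)) ∂ρ| ≤ M / L := by
  have htc : Continuous fun x => max (-L) (min L (h x)) := continuous_const.max (continuous_const.min hh)
  have hti : Integrable (fun x => max (-L) (min L (h x))) ρ :=
    Integrable.of_bound htc.aestronglyMeasurable L (Eventually.of_forall fun x => by
      rw [Real.norm_eq_abs, abs_le]
      exact ⟨le_max_left _ _, max_le (by linarith) (min_le_left _ _)⟩)
  rw [← integral_sub hhi hti, ← Real.norm_eq_abs]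
  calc ‖∫ x, (h x - max (-L) (min L (h x))) ∂ρ‖ ≤ ∫ x, G x ^ 2 / L ∂ρ :=
        norm_integral_le_of_norm_le (hGi.div_const L) (Eventually.of_forall fun x => by
          rw [Real.norm_eq_abs]; exact abs_sub_trunc_le hhG hL x)
    _ = (∫ x, G x ^ 2 ∂ρ) / L := integral_div L _
    _ ≤ M / L := div_le_div_of_nonneg_right hM hL.le

/-- **Transfer of integrals along weak convergence under a uniform second-moment domination.**
If `κ_k → κ` weakly (probability measures), `h` is continuous, `|h| ≤ G` with `G` continuous, and
`∫ G² dκ_k ≤ M` for all `k`, then `h ∈ L¹(κ)` and `∫ h dκ_k → ∫ h dκ`. [folklore] -/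
theorem tendsto_integral_of_tendsto_of_sq_le {κs : ℕ → ProbabilityMeasure X} {κ : ProbabilityMeasure X}
    (hlim : Tendsto κs atTop (𝓝 κ)) {h G : X → ℝ} (hh : Continuous h) (hG : Continuous G)
    (hhG : ∀ x, |h x| ≤ G x) {M : ℝ} (hint : ∀ k, Integrable (fun x => G x ^ 2) (κs k : Measure X))
    (hM : ∀ k, ∫ x, G x ^ 2 ∂(κs k : Measure X) ≤ M) :
    Integrable h (κ : Measure X) ∧
      Tendsto (fun k => ∫ x, h x ∂(κs k : Measure X)) atTop (𝓝 (∫ x, h x ∂(κ : Measure X))) := by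
  have hG0 : ∀ x, 0 ≤ G x := fun x => (abs_nonneg _).trans (hhG x)
  have hG2c : Continuous fun x => G x ^ 2 := hG.pow 2
  obtain ⟨hG2i, hG2M⟩ := integrable_of_tendsto_of_integral_le hlim hG2c (fun x => by positivity) hint hM
  -- integrability of `h` : `|h| ≤ G ≤ 1 + G²`
  have hdom : ∀ x, |h x| ≤ 1 + G x ^ 2 := fun x => (hhG x).trans (by nlinarith [hG0 x])
  have hint_h : ∀ ρ : Measure X, Integrable (fun x => G x ^ 2) ρ → IsFiniteMeasure ρ → Integrable h ρ := by
    intro ρ hρ _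
    exact ((integrable_const (1:ℝ)).add hρ).mono' hh.aestronglyMeasurable
      (Eventually.of_forall fun x => by rw [Real.norm_eq_abs]; exact hdom x)
  have hhi : Integrable h (κ : Measure X) := hint_h _ hG2i inferInstance
  have hhik : ∀ k, Integrable h (κs k : Measure X) := fun k => hint_h _ (hint k) inferInstance
  refine ⟨hhi, Metric.tendsto_atTop.2 fun ε hε => ?_⟩
  -- truncation level
  set L : ℝ := 3 * (max M 0 + 1) / ε with hL
  have hL0 : 0 < L := by rw [hL]; positivity
  have hML : M / L ≤ ε / 3 := by
    rw [div_le_iff₀ hL0, hL]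
    have : M ≤ max M 0 := le_max_left _ _
    have h2 : ε / 3 * (3 * (max M 0 + 1) / ε) = max M 0 + 1 := by field_simp
    rw [h2]; linarith
  -- the truncated function as a bounded continuous function
  set hL_bcf : X →ᵇ ℝ := BoundedContinuousFunction.mkOfBound
    ⟨fun x => max (-L) (min L (h x)), continuous_const.max (continuous_const.min hh)⟩ (2 * L)
    (fun x y => by
      simp only [ContinuousMap.coe_mk, Real.dist_eq]
      have b1 : ∀ z, |max (-L) (min L (h z))| ≤ L := fun z =>
        abs_le.2 ⟨le_max_left _ _, max_le (by linarith) (min_le_left _ _)⟩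
      calc _ ≤ |max (-L) (min L (h x))| + |max (-L) (min L (h y))| := abs_sub _ _
        _ ≤ L + L := add_le_add (b1 x) (b1 y)
        _ = 2 * L := by ring) with hbcf
  have hbcf_apply : ∀ x, hL_bcf x = max (-L) (min L (h x)) := fun x => rfl
  have hconv := (ProbabilityMeasure.tendsto_iff_forall_integral_tendsto.1 hlim) hL_bcf
  simp only [hbcf_apply] at hconv
  obtain ⟨K, hK⟩ := Metric.tendsto_atTop.1 hconv (ε / 3) (by positivity)
  refine ⟨K, fun k hk => ?_⟩
  have e1 := abs_integral_sub_integral_trunc_le (κs k : Measure X) hh hhG (hint k) (hM k) hL0 (hhik k)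
  have e2 := abs_integral_sub_integral_trunc_le (κ : Measure X) hh hhG hG2i hG2M hL0 hhi
  have e3 := hK k hk
  rw [Real.dist_eq] at e3 ⊢
  set A := ∫ x, h x ∂(κs k : Measure X)
  set B := ∫ x, max (-L) (min L (h x)) ∂(κs k : Measure X)
  set C := ∫ x, max (-L) (min L (h x)) ∂(κ : Measure X)
  set D := ∫ x, h x ∂(κ : Measure X)
  have key : |A - D| ≤ |A - B| + |B - C| + |D - C| := by
    calc |A - D| ≤ |A - B| + |B - D| := abs_sub_le A B D
      _ ≤ |A - B| + (|B - C| + |C - D|) := add_le_add le_rfl (abs_sub_le B C D)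
      _ = |A - B| + |B - C| + |D - C| := by rw [abs_sub_comm C D]; ring
  calc |A - D| ≤ |A - B| + |B - C| + |D - C| := key
    _ < ε := by linarith [e1.trans hML, e2.trans hML, e3]

end Transfer

/-! ### Site moments of the window measures -/

variable {ω₂ lam β γ T_L T_R : ℝ}

/-- **The window measures inherit the site-uniform moment bounds** (zero padding outside the chain):
for every `m` there is `C'` with `∫ (|q_z|^m + |p_z|^m) d((μ_N).map (embed N c)) ≤ C'` for all `N, c, z`,
the integrand being integrable. [folklore] -/
theorem site_moment_window_le (μ : (N : ℕ) → Measure (PhaseSpace N)) (hprob : ∀ N, IsProbabilityMeasure (μ N))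
    (hmom : ∀ m : ℕ, ∃ C : ℝ, ∀ (N : ℕ) (i : Fin N),
      Integrable (fun x : PhaseSpace N => |x.1 i| ^ m + |x.2 i| ^ m) (μ N) ∧
        ∫ x, (|x.1 i| ^ m + |x.2 i| ^ m) ∂(μ N) ≤ C) (m : ℕ) :
    ∃ C' : ℝ, 0 ≤ C' ∧ ∀ (N c : ℕ) (z : ℤ),
      Integrable (fun σ : ChainConfig => |(σ z).1| ^ m + |(σ z).2| ^ m) ((μ N).map (embed N c)) ∧
        ∫ σ, (|(σ z).1| ^ m + |(σ z).2| ^ m) ∂((μ N).map (embed N c)) ≤ C' := by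
  obtain ⟨C, hC⟩ := hmom m
  refine ⟨max C 2, le_max_of_le_right zero_le_two, fun N c z => ?_⟩
  have hcont : Continuous fun σ : ChainConfig => |(σ z).1| ^ m + |(σ z).2| ^ m :=
    ((continuous_abs.comp (continuous_fst.comp (continuous_apply z))).pow m).add
      ((continuous_abs.comp (continuous_snd.comp (continuous_apply z))).pow m)
  have hmeas := hcont.aestronglyMeasurable (μ := (μ N).map (embed N c))
  rw [integrable_map_measure hmeas (measurable_embed N c).aemeasurable,
    integral_map (measurable_embed N c).aemeasurable hmeas]
  by_cases h : 0 ≤ z + c ∧ z + c < N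
  · have he : ∀ x : PhaseSpace N, |(embed N c x z).1| ^ m + |(embed N c x z).2| ^ m =
        |x.1 ⟨(z + c).toNat, by omega⟩| ^ m + |x.2 ⟨(z + c).toNat, by omega⟩| ^ m := fun x => by
      simp only [embed_apply_of N c x h]
    simp only [Function.comp_def, he]
    exact ⟨(hC N _).1, (hC N _).2.trans (le_max_left _ _)⟩
  · have he : ∀ x : PhaseSpace N, |(embed N c x z).1| ^ m + |(embed N c x z).2| ^ m =
        |(0:ℝ)| ^ m + |(0:ℝ)| ^ m := fun x => by
      simp only [embed_apply_of_not N c x h]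
    simp only [Function.comp_def, he]
    haveI := hprob N
    refine ⟨integrable_const _, ?_⟩
    rw [integral_const, probReal_univ, one_smul]
    have : |(0:ℝ)| ^ m ≤ 1 := by
      rw [abs_zero]
      rcases Nat.eq_zero_or_pos m with hm | hm
      · simp [hm]
      · simp [zero_pow hm.ne']
    linarith [le_max_right C 2]

/-! ### Tightness of the window measures and Prokhorov extraction -/

/-- **Chebyshev on one site**: `ν {σ | r < ‖σ z‖} ≤ (∫ (q_z² + p_z²) dν) / r²` in `ℝ≥0∞` form. [folklore] -/
theorem measure_norm_site_gt_le (ν : Measure ChainConfig) [IsFiniteMeasure ν] (z : ℤ) {r : ℝ} (hr : 0 < r)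
    (hint : Integrable (fun σ : ChainConfig => |(σ z).1| ^ 2 + |(σ z).2| ^ 2) ν) {C : ℝ}
    (hC : ∫ σ, (|(σ z).1| ^ 2 + |(σ z).2| ^ 2) ∂ν ≤ C) :
    ν {σ | r < ‖σ z‖} ≤ ENNReal.ofReal (C / r ^ 2) := by
  have hmeas : AEMeasurable (fun σ : ChainConfig => ENNReal.ofReal (|(σ z).1| ^ 2 + |(σ z).2| ^ 2)) ν :=
    (ENNReal.measurable_ofReal.comp ((((continuous_abs.comp (continuous_fst.comp (continuous_apply z))).pow 2).add
      ((continuous_abs.comp (continuous_snd.comp (continuous_apply z))).pow 2)).measurable)).aemeasurable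
  have hsub : {σ : ChainConfig | r < ‖σ z‖} ⊆
      {σ | ENNReal.ofReal (r ^ 2) ≤ ENNReal.ofReal (|(σ z).1| ^ 2 + |(σ z).2| ^ 2)} := by
    intro σ hσ
    simp only [mem_setOf_eq] at hσ ⊢
    refine ENNReal.ofReal_le_ofReal ?_
    rw [Prod.norm_def, Real.norm_eq_abs, Real.norm_eq_abs] at hσ
    rcases lt_max_iff.1 hσ with h | h
    · nlinarith [sq_nonneg (|(σ z).2|), abs_nonneg ((σ z).1)]
    · nlinarith [sq_nonneg (|(σ z).1|), abs_nonneg ((σ z).2)]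
  calc ν {σ | r < ‖σ z‖} ≤ ν {σ | ENNReal.ofReal (r ^ 2) ≤ ENNReal.ofReal (|(σ z).1| ^ 2 + |(σ z).2| ^ 2)} :=
        measure_mono hsub
    _ ≤ (∫⁻ σ, ENNReal.ofReal (|(σ z).1| ^ 2 + |(σ z).2| ^ 2) ∂ν) / ENNReal.ofReal (r ^ 2) :=
        meas_ge_le_lintegral_div hmeas (by simp [hr.ne']) ENNReal.ofReal_ne_top
    _ = ENNReal.ofReal (∫ σ, (|(σ z).1| ^ 2 + |(σ z).2| ^ 2) ∂ν) / ENNReal.ofReal (r ^ 2) := by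
        rw [ofReal_integral_eq_lintegral_ofReal hint (Eventually.of_forall fun σ => by positivity)]
    _ ≤ ENNReal.ofReal C / ENNReal.ofReal (r ^ 2) := by gcongr
    _ = ENNReal.ofReal (C / r ^ 2) := (ENNReal.ofReal_div_of_pos (by positivity)).symm

/-- The geometric weights `2^{-|z|}` are summable over `ℤ`. [folklore] -/
theorem summable_half_pow_natAbs : Summable fun z : ℤ => (1 / 2 : ℝ) ^ z.natAbs := by
  refine Summable.of_nat_of_neg_add_one ?_ ?_
  · simpa using summable_geometric_of_lt_one (by norm_num : (0:ℝ) ≤ 1 / 2) (by norm_num)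
  · have : (fun n : ℕ => (1 / 2 : ℝ) ^ (-((n : ℤ) + 1)).natAbs) = fun n => (1 / 2 : ℝ) ^ (n + 1) := by
      funext n; congr 1
    rw [this]
    exact (summable_geometric_of_lt_one (by norm_num : (0:ℝ) ≤ 1 / 2) (by norm_num)).comp_injective
      (fun a b h => by simpa using h)

/-- **Tightness of a family of measures on configurations with site-uniform second moments**: if every
`ν ∈ S` is a probability measure with `∫ (q_z² + p_z²) dν ≤ C` for all sites `z`, then `S` is tight
(compact set: a product of closed balls of radii `r_z → ∞`; Chebyshev on each site). [folklore] -/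
theorem isTightMeasureSet_of_site_moments (S : Set (Measure ChainConfig)) {C : ℝ}
    (hS : ∀ ν ∈ S, IsProbabilityMeasure ν ∧ ∀ z : ℤ,
      Integrable (fun σ : ChainConfig => |(σ z).1| ^ 2 + |(σ z).2| ^ 2) ν ∧
        ∫ σ, (|(σ z).1| ^ 2 + |(σ z).2| ^ 2) ∂ν ≤ C) :
    IsTightMeasureSet S := by
  rw [isTightMeasureSet_iff_exists_isCompact_measure_compl_le]
  intro ε hε
  -- reduce to a real `δ > 0` with `ofReal δ ≤ ε`
  obtain ⟨δ, hδ, hδε⟩ : ∃ δ : ℝ, 0 < δ ∧ ENNReal.ofReal δ ≤ ε := by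
    rcases eq_or_ne ε ⊤ with h | h
    · exact ⟨1, one_pos, h ▸ le_top⟩
    · refine ⟨ε.toReal, ENNReal.toReal_pos hε.ne' h, ?_⟩
      rw [ENNReal.ofReal_toReal h]
  set Ssum : ℝ := ∑' z : ℤ, (1 / 2 : ℝ) ^ z.natAbs with hSsum
  have hSsum0 : 0 < Ssum := by
    rw [hSsum]
    exact summable_half_pow_natAbs.tsum_pos (fun z => by positivity) 0 (by norm_num)
  set C' : ℝ := max C 1 with hC'
  have hC'0 : 0 < C' := lt_of_lt_of_le one_pos (le_max_right _ _)
  -- radii: `C' / r_z² = δ 2^{-|z|} / Ssum`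
  set w : ℤ → ℝ := fun z => δ * (1 / 2 : ℝ) ^ z.natAbs / Ssum with hw
  have hwf : w = fun z => (δ / Ssum) * (1 / 2 : ℝ) ^ z.natAbs := by
    funext z; rw [hw]; ring
  have hw0 : ∀ z, 0 < w z := fun z => by rw [hw]; positivity
  set r : ℤ → ℝ := fun z => Real.sqrt (C' / w z) with hr
  have hr0 : ∀ z, 0 < r z := fun z => by rw [hr]; exact Real.sqrt_pos.2 (div_pos hC'0 (hw0 z))
  have hr2 : ∀ z, C' / r z ^ 2 = w z := fun z => by
    rw [hr, Real.sq_sqrt (div_pos hC'0 (hw0 z)).le]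
    field_simp
  set K : Set ChainConfig := Set.pi univ fun z => Metric.closedBall (0 : ℝ × ℝ) (r z) with hK
  refine ⟨K, isCompact_univ_pi fun z => isCompact_closedBall _ _, fun ν hν => ?_⟩
  obtain ⟨hprob, hmomν⟩ := hS ν hν
  have hcompl : Kᶜ ⊆ ⋃ z : ℤ, {σ : ChainConfig | r z < ‖σ z‖} := by
    intro σ hσ
    simp only [hK, mem_compl_iff, mem_univ_pi, Metric.mem_closedBall, dist_zero_right, not_forall, not_le] at hσ
    obtain ⟨z, hz⟩ := hσ
    exact mem_iUnion.2 ⟨z, hz⟩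
  calc ν Kᶜ ≤ ν (⋃ z : ℤ, {σ : ChainConfig | r z < ‖σ z‖}) := measure_mono hcompl
    _ ≤ ∑' z : ℤ, ν {σ : ChainConfig | r z < ‖σ z‖} := measure_iUnion_le _
    _ ≤ ∑' z : ℤ, ENNReal.ofReal (w z) := ENNReal.tsum_le_tsum fun z => by
        rw [← hr2 z]
        exact measure_norm_site_gt_le ν z (hr0 z) (hmomν z).1 ((hmomν z).2.trans (le_max_left _ _))
    _ = ENNReal.ofReal (∑' z : ℤ, w z) :=
        (ENNReal.ofReal_tsum_of_nonneg (fun z => (hw0 z).le) ?_).symm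
    _ = ENNReal.ofReal δ := by
        congr 1
        rw [hwf, tsum_mul_left, ← hSsum]
        field_simp
    _ ≤ ε := hδε
  · rw [hwf]
    exact summable_half_pow_natAbs.mul_left _

/-- **Prokhorov extraction for the centred window measures.** For a family of probability measures
`μ_N` on the `N`-chain phase spaces with site-uniform second moments and any sequence of lengths `Nk`,
a subsequence of the window measures `windowPM (μ (Nk k))` converges weakly to a probability measure on
configurations. [Prokhorov's theorem, Mathlib `isCompact_closure_of_isTightMeasureSet`] [folklore] -/
theorem exists_weak_limit_of_moments (μ : (N : ℕ) → Measure (PhaseSpace N))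
    (hprob : ∀ N, IsProbabilityMeasure (μ N))
    (hmom : ∀ m : ℕ, ∃ C : ℝ, ∀ (N : ℕ) (i : Fin N),
      Integrable (fun x : PhaseSpace N => |x.1 i| ^ m + |x.2 i| ^ m) (μ N) ∧
        ∫ x, (|x.1 i| ^ m + |x.2 i| ^ m) ∂(μ N) ≤ C)
    (Nk : ℕ → ℕ) :
    ∃ (ψ : ℕ → ℕ) (ν : Measure ChainConfig) (_ : IsProbabilityMeasure ν), StrictMono ψ ∧
      Tendsto (fun k => (haveI := hprob (Nk (ψ k)); windowPM (μ (Nk (ψ k))))) atTop (𝓝 (toPM ν)) := by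
  obtain ⟨C', -, hC'⟩ := site_moment_window_le μ hprob hmom 2
  set u : ℕ → ProbabilityMeasure ChainConfig := fun k => haveI := hprob (Nk k); windowPM (μ (Nk k)) with hu
  set S : Set (ProbabilityMeasure ChainConfig) := range u with hSdef
  have htight : IsTightMeasureSet {((x : ProbabilityMeasure ChainConfig) : Measure ChainConfig) | x ∈ S} := by
    refine isTightMeasureSet_of_site_moments _ (C := C') fun ν hν => ?_
    obtain ⟨x, ⟨k, rfl⟩, rfl⟩ := hν
    refine ⟨inferInstance, fun z => ?_⟩
    haveI := hprob (Nk k)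
    have h := hC' (Nk k) (Nk k / 2) z
    rw [hu]
    simpa only [coe_windowPM] using h
  have hcomp : IsCompact (closure S) := isCompact_closure_of_isTightMeasureSet htight
  obtain ⟨a, -, ψ, hψ, hlim⟩ := hcomp.isSeqCompact fun k => subset_closure (mem_range_self k)
  refine ⟨ψ, (a : Measure ChainConfig), a.prop, hψ, ?_⟩
  have ha : toPM (a : Measure ChainConfig) = a := Subtype.ext rfl
  rw [ha]
  exact hlim

/-- **The extraction in the form used by the `WindowLimit` assembly** (steady-state family). [folklore] -/
theorem exists_weak_limit (μ : (N : ℕ) → Measure (PhaseSpace N))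
    (hss : ∀ N, (pinnedChain ω₂ lam β γ).IsSteadyState N T_L T_R (μ N))
    (hmom : ∀ m : ℕ, ∃ C : ℝ, ∀ (N : ℕ) (i : Fin N),
      Integrable (fun x : PhaseSpace N => |x.1 i| ^ m + |x.2 i| ^ m) (μ N) ∧
        ∫ x, (|x.1 i| ^ m + |x.2 i| ^ m) ∂(μ N) ≤ C)
    (Nk : ℕ → ℕ) :
    ∃ (ψ : ℕ → ℕ) (ν : Measure ChainConfig) (_ : IsProbabilityMeasure ν), StrictMono ψ ∧
      Tendsto (fun k => (haveI := (hss (Nk (ψ k))).1; windowPM (μ (Nk (ψ k))))) atTop (𝓝 (toPM ν)) :=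
  exists_weak_limit_of_moments μ (fun N => (hss N).1) hmom Nk

end Summit.AtomisticToContinuum.FouriersLaw.Theorems.WindowLimit

end
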